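import Summits.Ventures.HSemireg.WedgeHankelRecurrenceGaussLaguerreInequality

/-!
# Venture HSemireg — **THE LARGEST ZERO IS A CONVEX, THE SMALLEST A CONCAVE FUNCTION OF THE DIAGONAL RECURRENCE COEFFICIENTS**: for three positive recurrences with the same `b` and diagonals
# `a`, `a'`, `a'' = (1 − s)a + s a'` (`0 ≤ s ≤ 1`, coefficient-wise on `i ≤ t`), the top zeros of `q_{t+1}`, `q'_{t+1}`, `q''_{t+1}` satisfy `x''_t ≤ (1 − s) x_t + s x'_t` and the bottom
# zeros `x''_0 ≥ (1 − s) x_0 + s x'_0` — the `x`-form `Σ μ x P²` is AFFINE in the diagonal (N323) and the extreme zeros are its extreme Rayleigh values (N301 ∕ N325)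

HONEST FRAMING. Part of the Lean index of the computation cell `pub-hsemireg` (seat p10 gen 44, Sunday typer «UNIFORM-IN-n»).  Real polynomials and finite sums only; no variety, no cohomology
theory, no sheaf, no Ext group and no semiregularity map is constructed here; nothing here says that HC / HC_CM / HC_AV holds; no Literature fact (unproved `Prop`) is declared or used.  Custodian
versions as in `WedgeHankelSiegelIdeal` (1/3).
SOURCES (cited).  Ky Fan, *On a theorem of Weyl concerning eigenvalues of linear transformations I*, Proc. Nat. Acad. Sci. 35 (1949) 652–655 (the largest eigenvalue of a Hermitian matrix is a
convex function of the matrix); R. A. Horn, C. R. Johnson, *Matrix Analysis* (2nd ed.) Thm 4.3.27 ∕ Cor. 4.3.15; M. E. H. Ismail, *Classical and Quantum Orthogonal Polynomials* (2005) §7.3.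
PROOF TYPED HERE.  With the Christoffel–Darboux vector `v` of `q''` at its top zero (N325 `cd_vector_eval_eq_zero`): `Σ μ'' x'' P''_v² = x''_t·G(v)`, `G(v) = Σ h_i v_i² > 0` (`v_t = q''_t(x''_t)
≠ 0`); by N323 `favard_x_form_sub` the three `x`-forms of the same coefficient vector differ by `Σ (Δa)_i h_i v_i²`, so `F''(v) = (1−s)F(v) + sF'(v) ≤ ((1−s)x_t + s x'_t)·G(v)` by N301.  The
bottom zero symmetrically with the vector at `x''_0` and N301's lower bound.
DEDUP DISCLOSURE (`rg -n 'convex|concave|TopZeroConvex' Summits/Ventures/HSemireg`, 2026-09-03): N323 (monotone), N324 (1-Lipschitz) and N325 (monotone in `b`) are the tree's statements on the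
dependence of the zeros on the coefficients; convexity is new.  The 3 names below: 0 hits tree-wide.

WHAT IS IN THE TREE.  N323 `favard_pairing_at_zeros`, `favard_norm_sq_combination`, `favard_x_form_sub`; N325 `cd_vector_eval_eq_zero`; N301 `sum_mul_node_mul_sq_le_last`,
`first_mul_sum_mul_sq_le`; N274 `recurrence_no_common_root`.
THIS FILE (namespace `Summit.Ventures.HSemireg.Wedge.HankelOuter` continued; CHAINED on N334 (import only); 0 definitions):
* §1100 `cd_vector_forms_at_zero` (for the Christoffel–Darboux vector `v` at the zero `x_{k₀}`, `P = Σ v_i q_i`: `Σ μ x P² = x_{k₀} Σ μ P²` and `Σ μ P² = Σ h v² > 0`), **`top_zero_convex_diagonal`**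
  (`x''_t ≤ (1−s)x_t + s x'_t`), **`bottom_zero_concave_diagonal`** (`(1−s)x_0 + s x'_0 ≤ x''_0`).
CAVEATS.  Positive recurrences sharing `b`; `0 ≤ s ≤ 1`; the interpolation `a'' = (1−s)a + s a'` is required only for `i ≤ t`.  Nothing Ext-side.  New names only.
-/

open Module Polynomial
open scoped Matrix Polynomial

namespace Summit.Ventures.HSemireg.Wedge.HankelOuter

/-! ## §1100. Convexity of the extreme zeros in the diagonal coefficients -/

/-- **The forms at a Christoffel–Darboux vector**: for the zeros `x` of `q_{t+1}`, the Favard weights `μ` and `v_j = (b_{j+1}⋯b_t) q_j(x_{k₀})`, `P = Σ v_j q_j` satisfies `Σ_k μ_k x_k P(x_k)² =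
x_{k₀} Σ_k μ_k P(x_k)²` and `Σ_k μ_k P(x_k)² = Σ_i h_i v_i² > 0`. [N325 repackaged; this file, §1100] -/
theorem cd_vector_forms_at_zero {q : ℕ → ℝ[X]} {a b : ℕ → ℝ} (hq0 : q 0 = 1) (hq1 : q 1 = Polynomial.X - C (a 0))
    (hrec : ∀ n, q (n + 2) = (Polynomial.X - C (a (n + 1))) * q (n + 1) - C (b (n + 1)) * q n) (hb : ∀ j, 0 < b j)
    {t : ℕ} {x μ : Fin (t + 1) → ℝ} (hx : StrictMono x) (hxq : q (t + 1) = ∏ j, (Polynomial.X - C (x j)))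
    (hpair : ∀ i j : Fin (t + 1), ∑ k, μ k * ((q i).eval (x k) * (q j).eval (x k)) = if i = j then ∏ l ∈ Finset.Ico 1 ((j : ℕ) + 1), b l else 0) (k₀ : Fin (t + 1))
    {v : Fin (t + 1) → ℝ} (hv : ∀ i, v i = (∏ l ∈ Finset.Ico ((i : ℕ) + 1) (t + 1), b l) * (q i).eval (x k₀)) :
    ∑ k, μ k * (x k * ((∑ i : Fin (t + 1), C (v i) * q i).eval (x k)) ^ 2) = x k₀ * ∑ k, μ k * ((∑ i : Fin (t + 1), C (v i) * q i).eval (x k)) ^ 2 ∧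
      ∑ k, μ k * ((∑ i : Fin (t + 1), C (v i) * q i).eval (x k)) ^ 2 = ∑ i : Fin (t + 1), (∏ l ∈ Finset.Ico 1 ((i : ℕ) + 1), b l) * v i ^ 2 ∧
      0 < ∑ i : Fin (t + 1), (∏ l ∈ Finset.Ico 1 ((i : ℕ) + 1), b l) * v i ^ 2 := by
  have hPv : (∑ i : Fin (t + 1), C (v i) * q i) = ∑ i : Fin (t + 1), C ((∏ l ∈ Finset.Ico ((i : ℕ) + 1) (t + 1), b l) * (q i).eval (x k₀)) * q i :=
    Finset.sum_congr rfl fun i _ => by rw [hv i]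
  set P : ℝ[X] := ∑ i : Fin (t + 1), C (v i) * q i with hP
  have hPx : ∀ k, k ≠ k₀ → P.eval (x k) = 0 := fun k hk => by rw [hPv]; exact cd_vector_eval_eq_zero hq0 hq1 hrec hx hxq hk
  refine ⟨?_, favard_norm_sq_combination (h := fun n => ∏ l ∈ Finset.Ico 1 (n + 1), b l) hpair v, ?_⟩
  · rw [Finset.sum_eq_single k₀ (fun k _ hk => by rw [hPx k hk]; ring) (fun h => absurd (Finset.mem_univ _) h),
      Finset.sum_eq_single k₀ (fun k _ hk => by rw [hPx k hk]; ring) (fun h => absurd (Finset.mem_univ _) h)]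
    ring
  · -- the last entry is `q_t(x_{k₀}) ≠ 0`
    have hxr : (q (t + 1)).eval (x k₀) = 0 := by
      rw [hxq, eval_prod]; exact Finset.prod_eq_zero (Finset.mem_univ k₀) (by rw [eval_sub, eval_X, eval_C, sub_self])
    have hlast : (q t).eval (x k₀) ≠ 0 := fun h => recurrence_no_common_root hq0 hq1 hrec hb t h hxr
    refine Finset.sum_pos' (fun i _ => mul_nonneg (Finset.prod_nonneg fun l _ => (hb l).le) (sq_nonneg _)) ⟨Fin.last t, Finset.mem_univ _, ?_⟩
    refine mul_pos (Finset.prod_pos fun l _ => hb l) (sq_pos_iff.2 ?_)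
    rw [hv, Fin.val_last]
    exact mul_ne_zero (Finset.prod_ne_zero_iff.2 fun l _ => (hb l).ne') hlast

/-- **KY FAN ∕ WEYL CONVEXITY OF THE LARGEST ZERO IN THE DIAGONAL: `x''_t ≤ (1 − s) x_t + s x'_t`** when `a''_i = (1−s) a_i + s a'_i` (`i ≤ t`, `0 ≤ s ≤ 1`, same `b > 0`).
[Ky Fan 1949; Horn–Johnson Thm 4.3.27; this file, §1100] -/
theorem top_zero_convex_diagonal {q q' q'' : ℕ → ℝ[X]} {a a' a'' b : ℕ → ℝ}
    (hq0 : q 0 = 1) (hq1 : q 1 = Polynomial.X - C (a 0)) (hrec : ∀ n, q (n + 2) = (Polynomial.X - C (a (n + 1))) * q (n + 1) - C (b (n + 1)) * q n)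
    (hq0' : q' 0 = 1) (hq1' : q' 1 = Polynomial.X - C (a' 0)) (hrec' : ∀ n, q' (n + 2) = (Polynomial.X - C (a' (n + 1))) * q' (n + 1) - C (b (n + 1)) * q' n)
    (hq0'' : q'' 0 = 1) (hq1'' : q'' 1 = Polynomial.X - C (a'' 0)) (hrec'' : ∀ n, q'' (n + 2) = (Polynomial.X - C (a'' (n + 1))) * q'' (n + 1) - C (b (n + 1)) * q'' n)
    (hb : ∀ j, 0 < b j) {t : ℕ} {s : ℝ} (hs0 : 0 ≤ s) (hs1 : s ≤ 1) (ha'' : ∀ i, i ≤ t → a'' i = (1 - s) * a i + s * a' i)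
    {x y w : Fin (t + 1) → ℝ} (hx : StrictMono x) (hxq : q (t + 1) = ∏ j, (Polynomial.X - C (x j))) (hy : StrictMono y) (hyq : q' (t + 1) = ∏ j, (Polynomial.X - C (y j)))
    (hw : StrictMono w) (hwq : q'' (t + 1) = ∏ j, (Polynomial.X - C (w j))) :
    w (Fin.last t) ≤ (1 - s) * x (Fin.last t) + s * y (Fin.last t) := by
  obtain ⟨μ, hμ, hpair⟩ := favard_pairing_at_zeros hq0 hq1 hrec hb hx hxq
  obtain ⟨μ', hμ', hpair'⟩ := favard_pairing_at_zeros hq0' hq1' hrec' hb hy hyq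
  obtain ⟨μ'', hμ'', hpair''⟩ := favard_pairing_at_zeros hq0'' hq1'' hrec'' hb hw hwq
  have hxr : ∀ j, (q (t + 1)).eval (x j) = 0 := fun j => by
    rw [hxq, eval_prod]; exact Finset.prod_eq_zero (Finset.mem_univ j) (by rw [eval_sub, eval_X, eval_C, sub_self])
  have hyr : ∀ j, (q' (t + 1)).eval (y j) = 0 := fun j => by
    rw [hyq, eval_prod]; exact Finset.prod_eq_zero (Finset.mem_univ j) (by rw [eval_sub, eval_X, eval_C, sub_self])
  have hwr : ∀ j, (q'' (t + 1)).eval (w j) = 0 := fun j => by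
    rw [hwq, eval_prod]; exact Finset.prod_eq_zero (Finset.mem_univ j) (by rw [eval_sub, eval_X, eval_C, sub_self])
  -- the Christoffel–Darboux vector of `q''` at its top zero
  obtain ⟨v, hv⟩ : ∃ v : Fin (t + 1) → ℝ, v = fun (i : Fin (t + 1)) => (∏ l ∈ Finset.Ico ((i : ℕ) + 1) (t + 1), b l) * (q'' i).eval (w (Fin.last t)) := ⟨_, rfl⟩
  obtain ⟨hF'', hG'', hGpos⟩ := cd_vector_forms_at_zero hq0'' hq1'' hrec'' hb hw hwq hpair'' (Fin.last t) (v := v) (fun i => by rw [hv])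
  -- the three `x`-forms of the same coefficient vector
  have hG : ∑ k, μ k * ((∑ i : Fin (t + 1), C (v i) * q i).eval (x k)) ^ 2 = ∑ i : Fin (t + 1), (∏ l ∈ Finset.Ico 1 ((i : ℕ) + 1), b l) * v i ^ 2 :=
    favard_norm_sq_combination (h := fun n => ∏ l ∈ Finset.Ico 1 (n + 1), b l) hpair v
  have hG' : ∑ k, μ' k * ((∑ i : Fin (t + 1), C (v i) * q' i).eval (y k)) ^ 2 = ∑ i : Fin (t + 1), (∏ l ∈ Finset.Ico 1 ((i : ℕ) + 1), b l) * v i ^ 2 :=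
    favard_norm_sq_combination (h := fun n => ∏ l ∈ Finset.Ico 1 (n + 1), b l) hpair' v
  have hd1 := favard_x_form_sub hq0 hq1 hrec hq0'' hq1'' hrec'' hxr hwr hpair hpair'' v
  have hd2 := favard_x_form_sub hq0 hq1 hrec hq0' hq1' hrec' hxr hyr hpair hpair' v
  have hF := sum_mul_node_mul_sq_le_last hx (fun k => (hμ k).le) (∑ i : Fin (t + 1), C (v i) * q i)
  have hF' := sum_mul_node_mul_sq_le_last hy (fun k => (hμ' k).le) (∑ i : Fin (t + 1), C (v i) * q' i)
  rw [hG] at hF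
  rw [hG'] at hF'
  rw [hG''] at hF''
  -- affinity: `F'' − F = s (F' − F)`
  have haff : ∑ i : Fin (t + 1), (a'' i - a i) * (∏ l ∈ Finset.Ico 1 ((i : ℕ) + 1), b l) * v i ^ 2 = s * ∑ i : Fin (t + 1), (a' i - a i) * (∏ l ∈ Finset.Ico 1 ((i : ℕ) + 1), b l) * v i ^ 2 := by
    rw [Finset.mul_sum]
    exact Finset.sum_congr rfl fun i _ => by rw [ha'' i (Nat.lt_succ_iff.1 i.is_lt)]; ring
  rw [haff] at hd1
  set G := ∑ i : Fin (t + 1), (∏ l ∈ Finset.Ico 1 ((i : ℕ) + 1), b l) * v i ^ 2 with hGdef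
  have key : w (Fin.last t) * G ≤ ((1 - s) * x (Fin.last t) + s * y (Fin.last t)) * G := by
    have h1s : 0 ≤ 1 - s := sub_nonneg.2 hs1
    nlinarith [hF'', hd1, hd2, hF, hF', mul_le_mul_of_nonneg_left hF h1s, mul_le_mul_of_nonneg_left hF' hs0]
  exact le_of_mul_le_mul_right key hGpos

/-- **CONCAVITY OF THE SMALLEST ZERO IN THE DIAGONAL: `(1 − s) x_0 + s x'_0 ≤ x''_0`** under the same hypotheses. [Ky Fan 1949; Horn–Johnson Thm 4.3.27; this file, §1100] -/
theorem bottom_zero_concave_diagonal {q q' q'' : ℕ → ℝ[X]} {a a' a'' b : ℕ → ℝ}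
    (hq0 : q 0 = 1) (hq1 : q 1 = Polynomial.X - C (a 0)) (hrec : ∀ n, q (n + 2) = (Polynomial.X - C (a (n + 1))) * q (n + 1) - C (b (n + 1)) * q n)
    (hq0' : q' 0 = 1) (hq1' : q' 1 = Polynomial.X - C (a' 0)) (hrec' : ∀ n, q' (n + 2) = (Polynomial.X - C (a' (n + 1))) * q' (n + 1) - C (b (n + 1)) * q' n)
    (hq0'' : q'' 0 = 1) (hq1'' : q'' 1 = Polynomial.X - C (a'' 0)) (hrec'' : ∀ n, q'' (n + 2) = (Polynomial.X - C (a'' (n + 1))) * q'' (n + 1) - C (b (n + 1)) * q'' n)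
    (hb : ∀ j, 0 < b j) {t : ℕ} {s : ℝ} (hs0 : 0 ≤ s) (hs1 : s ≤ 1) (ha'' : ∀ i, i ≤ t → a'' i = (1 - s) * a i + s * a' i)
    {x y w : Fin (t + 1) → ℝ} (hx : StrictMono x) (hxq : q (t + 1) = ∏ j, (Polynomial.X - C (x j))) (hy : StrictMono y) (hyq : q' (t + 1) = ∏ j, (Polynomial.X - C (y j)))
    (hw : StrictMono w) (hwq : q'' (t + 1) = ∏ j, (Polynomial.X - C (w j))) :
    (1 - s) * x 0 + s * y 0 ≤ w 0 := by
  obtain ⟨μ, hμ, hpair⟩ := favard_pairing_at_zeros hq0 hq1 hrec hb hx hxq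
  obtain ⟨μ', hμ', hpair'⟩ := favard_pairing_at_zeros hq0' hq1' hrec' hb hy hyq
  obtain ⟨μ'', hμ'', hpair''⟩ := favard_pairing_at_zeros hq0'' hq1'' hrec'' hb hw hwq
  have hxr : ∀ j, (q (t + 1)).eval (x j) = 0 := fun j => by
    rw [hxq, eval_prod]; exact Finset.prod_eq_zero (Finset.mem_univ j) (by rw [eval_sub, eval_X, eval_C, sub_self])
  have hyr : ∀ j, (q' (t + 1)).eval (y j) = 0 := fun j => by
    rw [hyq, eval_prod]; exact Finset.prod_eq_zero (Finset.mem_univ j) (by rw [eval_sub, eval_X, eval_C, sub_self])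
  have hwr : ∀ j, (q'' (t + 1)).eval (w j) = 0 := fun j => by
    rw [hwq, eval_prod]; exact Finset.prod_eq_zero (Finset.mem_univ j) (by rw [eval_sub, eval_X, eval_C, sub_self])
  obtain ⟨v, hv⟩ : ∃ v : Fin (t + 1) → ℝ, v = fun (i : Fin (t + 1)) => (∏ l ∈ Finset.Ico ((i : ℕ) + 1) (t + 1), b l) * (q'' i).eval (w 0) := ⟨_, rfl⟩
  obtain ⟨hF'', hG'', hGpos⟩ := cd_vector_forms_at_zero hq0'' hq1'' hrec'' hb hw hwq hpair'' 0 (v := v) (fun i => by rw [hv])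
  have hG : ∑ k, μ k * ((∑ i : Fin (t + 1), C (v i) * q i).eval (x k)) ^ 2 = ∑ i : Fin (t + 1), (∏ l ∈ Finset.Ico 1 ((i : ℕ) + 1), b l) * v i ^ 2 :=
    favard_norm_sq_combination (h := fun n => ∏ l ∈ Finset.Ico 1 (n + 1), b l) hpair v
  have hG' : ∑ k, μ' k * ((∑ i : Fin (t + 1), C (v i) * q' i).eval (y k)) ^ 2 = ∑ i : Fin (t + 1), (∏ l ∈ Finset.Ico 1 ((i : ℕ) + 1), b l) * v i ^ 2 :=
    favard_norm_sq_combination (h := fun n => ∏ l ∈ Finset.Ico 1 (n + 1), b l) hpair' v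
  have hd1 := favard_x_form_sub hq0 hq1 hrec hq0'' hq1'' hrec'' hxr hwr hpair hpair'' v
  have hd2 := favard_x_form_sub hq0 hq1 hrec hq0' hq1' hrec' hxr hyr hpair hpair' v
  have hF := first_mul_sum_mul_sq_le hx (fun k => (hμ k).le) (∑ i : Fin (t + 1), C (v i) * q i)
  have hF' := first_mul_sum_mul_sq_le hy (fun k => (hμ' k).le) (∑ i : Fin (t + 1), C (v i) * q' i)
  rw [hG] at hF
  rw [hG'] at hF'
  rw [hG''] at hF''
  have haff : ∑ i : Fin (t + 1), (a'' i - a i) * (∏ l ∈ Finset.Ico 1 ((i : ℕ) + 1), b l) * v i ^ 2 = s * ∑ i : Fin (t + 1), (a' i - a i) * (∏ l ∈ Finset.Ico 1 ((i : ℕ) + 1), b l) * v i ^ 2 := by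
    rw [Finset.mul_sum]
    exact Finset.sum_congr rfl fun i _ => by rw [ha'' i (Nat.lt_succ_iff.1 i.is_lt)]; ring
  rw [haff] at hd1
  set G := ∑ i : Fin (t + 1), (∏ l ∈ Finset.Ico 1 ((i : ℕ) + 1), b l) * v i ^ 2 with hGdef
  have key : ((1 - s) * x 0 + s * y 0) * G ≤ w 0 * G := by
    have h1s : 0 ≤ 1 - s := sub_nonneg.2 hs1
    nlinarith [hF'', hd1, hd2, hF, hF', mul_le_mul_of_nonneg_left hF h1s, mul_le_mul_of_nonneg_left hF' hs0]
  exact le_of_mul_le_mul_right key hGpos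

end Summit.Ventures.HSemireg.Wedge.HankelOuter
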